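import HarnessLib
import Summits.CriticalPhenomena.Ising3DConformalLimit.Theorems.HyperoctahedralRPTwoPointKernelOfLimitClauses
import Summits.CriticalPhenomena.Ising3DConformalLimit.Theorems.HyperoctahedralRPExistsScaleCovariantLimitCompactnessItemMapsDoubling
import Summits.CriticalPhenomena.Ising3DConformalLimit.Theorems.HyperoctahedralRPExistsScaleCovariantLimitDoublingOfDyadicPairRatio
import Summits.CriticalPhenomena.Ising3DConformalLimit.Theorems.HarmonicMomentsIsotropyTwoPointAsymptoticIsotropyRayWindow
import Literature.Probability.LatticeModels.EvenMomentWickDeviation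

/-!
# Vague asymptotic isotropy of the critical `ℤ³` two-point function, XXVIII:
# RAY REGULAR VARIATION — doubling, cluster points, homogeneity of cluster kernels
(route HarmonicMomentsIsotropy, support item stmt-CriticalPhenomena-6036 `TwoPointAsymptoticIsotropy`;
second file of the ray-regular-variation line of seat c4)

Write `G = criticalTwoPoint 3` for the critical two-point function of the nearest-neighbour Ising model
on `ℤ³`. RAY REGULAR VARIATION with exponent `a` is the purely radial hypothesis

  `RayRV[a]`: for every lattice direction `x ∈ ℤ³ ∖ {0}` and every `k ≥ 1`,
  `G(k m x) / G(m x) → k^{-a}` as `m → ∞`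

(each lattice ray carries a regularly varying sequence, with a common index; nothing is assumed about
the comparison of different rays, i.e. about the angular profile). This file proves:

* `tendsto_dyadicPairRatio_of_rayRV`, `twoPointDoubling_of_rayRV`, `uniformRegularity_of_rayRV` — on the
  axis ray, `RayRV` gives the convergence of the doubling ratio `g(2^{j+1})/g(2^j)`, hence item 6150
  `TwoPointDoubling` (tree `stub_twoPointDoubling_of_dyadicPairRatio`) and item 4658 `UniformRegularity`
  of the pinned zoom (tree `uniformRegularity_of_doubling`, the reflection-positivity pedigree
  machinery of crux 1344 / 1981);
* `exists_seqLimit_of_uniformRegularity` — along every mesh sequence `u k → 0⁺` a subsequence of the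
  pinned zoom converges, at every order, locally uniformly off the diagonals, to a family positive at
  order two (the tree's Arzelà–Ascoli schema `compactnessSchema`, with the PINNED renormalisation
  `ρ_pin` kept explicit);
* `kernel_ray_scaling_of_rayRV`, `kernel_homogeneous_of_rayRV` — the kernel `K = S₂(0,·)` of every
  sequential pair limit (any `ρ > 0`) is HOMOGENEOUS of degree `-a`: `K(k s x̂) = k^{-a} K(s x̂)` on
  rescaled lattice rays by continuous convergence (`TendstoLocallyUniformlyOn.tendsto_comp` at the
  moving rescaled sites `u_j ⌊s/u_j⌋ x̂ → s x̂`) and `RayRV` along `m_j = ⌊s/u_j⌋ → ∞`; then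
  `K(c y) = c^{-a} K(y)` for all `c > 0`, `y ≠ 0` by rational dilations of rational points and the
  continuity of `K` off `0`;
(The window `1 ≤ a ≤ 2` is file XXVIII-W `…TwoPointAsymptoticIsotropyRayWindow`.)

References: H. Duminil-Copin, ICM 2022, §8.1, §8.4 [DuminilCopinICM2022]; M. Aizenman,
H. Duminil-Copin, Ann. of Math. 194 (2021), arXiv:1912.07973, §5 [AizenmanDuminilCopinAnnals2021];
N. H. Bingham, C. M. Goldie, J. L. Teugels, *Regular Variation* (CUP 1987), §1.9 (regularly varying
sequences). No definitions are introduced (`RayRV[a]` is a local notation).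
-/

noncomputable section

namespace Summit.CriticalPhenomena.Ising3DConformalLimit.HarmonicMomentsIsotropyTwoPoint.RayRV

open Literature.Probability.LatticeModels Filter Set
open scoped Topology
open Summit.CriticalPhenomena.Ising3DConformalLimit.MoebiusLimitExistsOnlyInteraction
  (rhoPin rhoPin_pos compactnessSchema)
open Summit.CriticalPhenomena.Ising3DConformalLimit.MoebiusLimitExistsNegative
  (rescaled_pin_cfg0s)
open Summit.CriticalPhenomena.Ising3DConformalLimit.HyperoctahedralRPTwoPoint
open Summit.CriticalPhenomena.Ising3DConformalLimit.Cruxes.ExistsScaleCovariantLimit.TwoHierarchies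
  (continuousOn_seqLimit stub_twoPointDoubling_of_dyadicPairRatio rhoStar_eq_rhoPin
   )
open Summit.CriticalPhenomena.Ising3DConformalLimit.Cruxes.ExistsScaleCovariantLimit.TwoHierarchies.ItemMaps
  (uniformRegularity_of_doubling eventually_mem_Ioo_of_tendsto_nhdsGT')
open Summit.CriticalPhenomena.Ising3DConformalLimit.Theses

/-- `RayRV[a]`: RAY REGULAR VARIATION of the critical two-point function with exponent `a` — on every
lattice ray `ℕ·x`, `x ∈ ℤ³ ∖ {0}`, `⟨σ₀σ_{kmx}⟩_{β_c} / ⟨σ₀σ_{mx}⟩_{β_c} → k^{-a}` as `m → ∞`, for every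
`k ≥ 1` (local notation, no new definition). -/
local notation3 (prettyPrint := false) "RayRV[" a "]" =>
  ∀ x : Site 3, x ≠ 0 → ∀ k : ℕ, 1 ≤ k →
    Tendsto (fun m : ℕ => criticalTwoPoint 3 (fun i => ((k * m : ℕ) : ℤ) * x i) /
      criticalTwoPoint 3 (fun i => ((m : ℕ) : ℤ) * x i)) atTop (𝓝 ((k : ℝ) ^ (-a)))

/-! ### Lattice bookkeeping -/

/-- `siteVec (c • x) = c • siteVec x`. [folklore] -/
theorem siteVec_intMul (c : ℤ) (x : Site 3) :
    siteVec (fun i => c * x i) = (c : ℝ) • siteVec x := by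
  ext i
  simp [siteVec_apply]

/-- `siteVec x ≠ 0` for `x ≠ 0`. [folklore] -/
theorem siteVec_ne_zero {x : Site 3} (hx : x ≠ 0) : siteVec x ≠ 0 := by
  intro h
  apply hx
  funext i
  have hi := congrArg (fun v : EuclideanSpace ℝ (Fin 3) => v i) h
  simp only [siteVec_apply, PiLp.zero_apply, Int.cast_eq_zero] at hi
  exact hi

/-- The renormalised pair correlator at the rescaled sites `(0, δ z)` is `ρ(δ)² ⟨σ₀σ_z⟩_{β_c}`.
[folklore] -/
theorem rescaledCorrelator_zero_smul_siteVec (ρ : ℝ → ℝ) {δ : ℝ} (hδ : 0 < δ) (z : Site 3) :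
    rescaledCorrelator (criticalCorr 3) ρ 2 δ
        (![0, δ • siteVec z] : Fin 2 → EuclideanSpace ℝ (Fin 3)) =
      ρ δ ^ 2 * criticalTwoPoint 3 z := by
  have h := rescaledCorrelator_two_smul_siteVec ρ hδ 0 z
  rw [siteVec_zero, smul_zero, criticalCorr_two] at h
  exact h

/-! ### Ray regular variation on the axis: doubling and uniform regularity -/

/-- **Ray regular variation gives the convergence of the dyadic doubling ratio**: the pinned pair zoom
at the mesh `2^{-j}` and the pair `(0, 2e₀)` is `g(2^{j+1})/g(2^j) → 2^{-a}`.
[cite: AizenmanDuminilCopinAnnals2021, Remark 5.10] -/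
theorem tendsto_dyadicPairRatio_of_rayRV {a : ℝ} (hRV : RayRV[a]) :
    Tendsto (fun j : ℕ => rescaledCorrelator (criticalCorr 3) rhoPin 2 (((2:ℝ) ^ j)⁻¹)
      (![0, EuclideanSpace.single 0 (2:ℝ)] : Fin 2 → EuclideanSpace ℝ (Fin 3))) atTop
      (𝓝 ((2:ℝ) ^ (-a))) := by
  have he : (Pi.single (0 : Fin 3) (1 : ℤ) : Site 3) ≠ 0 := by
    intro h
    have := congr_fun h 0
    simp at this
  have h2 := (hRV (Pi.single 0 1) he 2 (by norm_num)).comp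
    (tendsto_pow_atTop_atTop_of_one_lt (one_lt_two : (1:ℕ) < 2))
  have h2r : (((2:ℕ) : ℝ)) = (2:ℝ) := by norm_num
  rw [h2r] at h2
  refine h2.congr fun j => ?_
  simp only [Function.comp_apply]
  rw [rescaled_pin_cfg0s, intMul_single_one, intMul_single_one]
  have hf1 : ⌊(2:ℝ) / ((2:ℝ) ^ j)⁻¹⌋ = ((2 * 2 ^ j : ℕ) : ℤ) := by
    rw [div_inv_eq_mul, show (2:ℝ) * 2 ^ j = ((2 * 2 ^ j : ℕ) : ℝ) by push_cast; ring,
      Int.floor_natCast]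
  have hf2 : ⌊(1:ℝ) / ((2:ℝ) ^ j)⁻¹⌋ = ((2 ^ j : ℕ) : ℤ) := by
    rw [div_inv_eq_mul, one_mul, show (2:ℝ) ^ j = ((2 ^ j : ℕ) : ℝ) by push_cast; ring,
      Int.floor_natCast]
  rw [hf1, hf2]

/-- **Ray regular variation gives item 6150 `TwoPointDoubling`** (`κ g(n) ≤ g(2n)` for all `n ≥ 1`):
the tree's `stub_twoPointDoubling_of_dyadicPairRatio` (one convergent dyadic pair ratio suffices, by
Messager–Miracle-Solé interpolation). [cite: AizenmanDuminilCopinAnnals2021, Remark 5.10] -/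
theorem twoPointDoubling_of_rayRV {a : ℝ} (hRV : RayRV[a]) :
    MirrorHoelderCompactness.TwoPointDoubling :=
  stub_twoPointDoubling_of_dyadicPairRatio ⟨_, tendsto_dyadicPairRatio_of_rayRV hRV⟩

/-- **Ray regular variation gives item 4658 `UniformRegularity`** of the pinned zoom (all orders), via
`TwoPointDoubling` and the tree's reflection-positivity pedigree machinery
(`uniformRegularity_of_doubling`). [cite: DuminilCopinICM2022, §8.4] -/
theorem uniformRegularity_of_rayRV {a : ℝ} (hRV : RayRV[a]) : MonotoneRG.UniformRegularity :=
  uniformRegularity_of_doubling (twoPointDoubling_of_rayRV hRV)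

/-! ### Cluster points of the pinned zoom along an arbitrary mesh sequence -/

/-- **Sequential compactness of the pinned zoom under `UniformRegularity`.** Along every mesh sequence
`u k → 0⁺` there are a subsequence `φ` and a family `S`, continuous off the diagonals, with
`ρ_pin(u (φ k))ⁿ ⟨∏σ_{[xᵢ/u(φ k)]}⟩_{β_c} → S n x` locally uniformly on `NonCoincident 3 n` for every `n`,
and `S 2 > 0` off the diagonal (the tree's Arzelà–Ascoli / diagonal schema `compactnessSchema`, fed
with clauses (a), (b) of `UniformRegularity`; clause (c) passes to the limit). [folklore] -/
theorem exists_seqLimit_of_uniformRegularity (hUR : MonotoneRG.UniformRegularity)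
    {u : ℕ → ℝ} (hu : Tendsto u atTop (𝓝[>] (0 : ℝ))) :
    ∃ (φ : ℕ → ℕ) (S : CorrFamily 3), StrictMono φ ∧
      (∀ n, ContinuousOn (S n) (NonCoincident 3 n)) ∧
      (∀ n, TendstoLocallyUniformlyOn
        (fun k => rescaledCorrelator (criticalCorr 3) rhoPin n (u (φ k))) (S n) atTop
        (NonCoincident 3 n)) ∧
      ∀ x ∈ NonCoincident 3 2, 0 < S 2 x := by
  unfold MonotoneRG.UniformRegularity at hUR
  rw [rhoStar_eq_rhoPin] at hUR
  obtain ⟨hab, hc⟩ := hUR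
  have hev : ∀ {δ₀ : ℝ}, 0 < δ₀ → ∀ᶠ k in atTop, u k ∈ Set.Ioo 0 δ₀ := fun hδ₀ =>
    eventually_mem_Ioo_of_tendsto_nhdsGT' hu hδ₀
  have hB : ∀ (n : ℕ) (K : Set (Fin n → EuclideanSpace ℝ (Fin 3))), IsCompact K →
      K ⊆ NonCoincident 3 n → ∃ B : ℝ, ∀ᶠ k in atTop, ∀ x ∈ K,
        |rescaledCorrelator (criticalCorr 3) rhoPin n (u k) x| ≤ B := by
    intro n K hK hKU
    obtain ⟨M, δ₀, hδ₀, hbd⟩ := (hab n K hKU hK).1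
    exact ⟨M, (hev hδ₀).mono fun k hk x hx => hbd _ hk x hx⟩
  have hE : ∀ (n : ℕ) (K : Set (Fin n → EuclideanSpace ℝ (Fin 3))), IsCompact K →
      K ⊆ NonCoincident 3 n → ∀ ε > 0, ∃ η > 0, ∀ᶠ k in atTop, ∀ x ∈ K, ∀ y ∈ K, dist x y < η →
        |rescaledCorrelator (criticalCorr 3) rhoPin n (u k) x -
          rescaledCorrelator (criticalCorr 3) rhoPin n (u k) y| < ε := by
    intro n K hK hKU ε hε
    obtain ⟨r, δ₀, hr, hδ₀, heq⟩ := (hab n K hKU hK).2 ε hε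
    exact ⟨r, hr, (hev hδ₀).mono fun k hk x hx y hy hxy => heq _ hk x hx y hy hxy⟩
  obtain ⟨φ, S, hφ, -, hScont, hconv⟩ :=
    compactnessSchema (fun n k => rescaledCorrelator (criticalCorr 3) rhoPin n (u k)) hB hE
  refine ⟨φ, S, hφ, hScont, hconv, ?_⟩
  intro x hx
  obtain ⟨m, δ₀, hm, hδ₀, hlow⟩ := hc {x} (Set.singleton_subset_iff.2 hx) isCompact_singleton
  have hevφ : ∀ᶠ k in atTop, m ≤ rescaledCorrelator (criticalCorr 3) rhoPin 2 (u (φ k)) x :=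
    (hφ.tendsto_atTop.eventually (hev hδ₀)).mono fun k hk => hlow _ hk x (Set.mem_singleton x)
  exact lt_of_lt_of_le hm (ge_of_tendsto ((hconv 2).tendsto_at hx) hevφ)

/-! ### Homogeneity of the kernel of a sequential pair limit under ray regular variation -/

/-- Continuous convergence of a sequential pair limit at moving rescaled lattice points `(0, u_j z_j)`
with `u_j z_j → y ≠ 0`: `ρ(u_j)² ⟨σ₀σ_{z_j}⟩_{β_c} → S₂(0, y)`. [folklore] -/
theorem tendsto_rescaled_movingSite {ρ : ℝ → ℝ} {u : ℕ → ℝ} (hu : Tendsto u atTop (𝓝[>] (0 : ℝ)))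
    {S2 : (Fin 2 → EuclideanSpace ℝ (Fin 3)) → ℝ}
    (hconv2 : TendstoLocallyUniformlyOn (fun k => rescaledCorrelator (criticalCorr 3) ρ 2 (u k)) S2 atTop
      (NonCoincident 3 2))
    {z : ℕ → Site 3} {y : EuclideanSpace ℝ (Fin 3)} (hy : y ≠ 0)
    (hz : Tendsto (fun j => u j • siteVec (z j)) atTop (𝓝 y)) :
    Tendsto (fun j => ρ (u j) ^ 2 * criticalTwoPoint 3 (z j)) atTop (𝓝 (S2 ![0, y])) := by
  have hupos : ∀ᶠ j in atTop, 0 < u j := hu.eventually self_mem_nhdsWithin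
  have hmem : (![0, y] : Fin 2 → EuclideanSpace ℝ (Fin 3)) ∈ NonCoincident 3 2 :=
    zero_pair_mem_nonCoincident hy
  have hcont : ContinuousWithinAt S2 (NonCoincident 3 2) ![0, y] :=
    continuousOn_seqLimit hu hconv2 _ hmem
  have hZ : Tendsto (fun j => (![0, u j • siteVec (z j)] : Fin 2 → EuclideanSpace ℝ (Fin 3)))
      atTop (𝓝 ![0, y]) := by
    rw [tendsto_pi_nhds]
    intro i
    fin_cases i
    · simp
    · simpa using hz
  have hZ' : Tendsto (fun j => (![0, u j • siteVec (z j)] : Fin 2 → EuclideanSpace ℝ (Fin 3)))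
      atTop (𝓝[NonCoincident 3 2] ![0, y]) :=
    tendsto_nhdsWithin_of_tendsto_nhds_of_eventually_within _ hZ
      (hZ.eventually ((isOpen_nonCoincident 3 2).mem_nhds hmem))
  have h := hconv2.tendsto_comp hcont hmem hZ'
  refine h.congr' ?_
  filter_upwards [hupos] with j hj
  exact rescaledCorrelator_zero_smul_siteVec ρ hj (z j)

/-- `u · ⌊s/u⌋₊ → s` along `u → 0⁺` (`s > 0`). [folklore] -/
theorem tendsto_mul_natFloor_div {u : ℕ → ℝ} (hu : Tendsto u atTop (𝓝[>] (0 : ℝ))) {s : ℝ}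
    (hs : 0 < s) : Tendsto (fun j => u j * (⌊s / u j⌋₊ : ℝ)) atTop (𝓝 s) := by
  have hupos : ∀ᶠ j in atTop, 0 < u j := hu.eventually self_mem_nhdsWithin
  have hu0 : Tendsto u atTop (𝓝 0) := tendsto_nhdsWithin_iff.1 hu |>.1
  -- `s - u ≤ u ⌊s/u⌋₊ ≤ s`
  refine tendsto_of_tendsto_of_tendsto_of_le_of_le' (g := fun j => s - u j) (h := fun _ => s) ?_
    tendsto_const_nhds ?_ ?_
  · have : Tendsto (fun j => s - u j) atTop (𝓝 (s - 0)) := tendsto_const_nhds.sub hu0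
    rwa [sub_zero] at this
  · filter_upwards [hupos] with j hj
    have h1 : s / u j < ⌊s / u j⌋₊ + 1 := Nat.lt_floor_add_one _
    have h2 : s < u j * ⌊s / u j⌋₊ + u j := by
      have := mul_lt_mul_of_pos_left h1 hj
      rwa [mul_div_cancel₀ _ hj.ne', mul_add, mul_one] at this
    linarith
  · filter_upwards [hupos] with j hj
    have h1 : (⌊s / u j⌋₊ : ℝ) ≤ s / u j := Nat.floor_le (div_nonneg hs.le hj.le)
    have := mul_le_mul_of_nonneg_left h1 hj.le
    rwa [mul_div_cancel₀ _ hj.ne'] at this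

/-- **Ray scaling of the kernel of a sequential pair limit.** Under `RayRV[a]`, for every sequential
pair limit `S₂` (renormalisation `ρ > 0` on `(0,1]`, `S₂ > 0` off the diagonal), every lattice
direction `x ≠ 0`, every `s > 0` and `k ≥ 1`: `S₂(0, (k s) x̂) = k^{-a} S₂(0, s x̂)`, `x̂ = siteVec x` —
the two values are limits of `ρ(u_j)² G(k m_j x)` and `ρ(u_j)² G(m_j x)` at the moving rescaled sites
(`m_j = ⌊s/u_j⌋`), whose ratio tends to `k^{-a}` by ray regular variation.
[cite: DuminilCopinICM2022, §8.4] -/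
theorem kernel_ray_scaling_of_rayRV {a : ℝ} (hRV : RayRV[a]) {ρ : ℝ → ℝ}
    (hρ : ∀ δ ∈ Set.Ioc (0:ℝ) 1, 0 < ρ δ) {u : ℕ → ℝ} (hu : Tendsto u atTop (𝓝[>] (0 : ℝ)))
    {S2 : (Fin 2 → EuclideanSpace ℝ (Fin 3)) → ℝ}
    (hconv2 : TendstoLocallyUniformlyOn (fun k => rescaledCorrelator (criticalCorr 3) ρ 2 (u k)) S2 atTop
      (NonCoincident 3 2))
    (hpos : ∀ z ∈ NonCoincident 3 2, 0 < S2 z)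
    {x : Site 3} (hx : x ≠ 0) {s : ℝ} (hs : 0 < s) {k : ℕ} (hk : 1 ≤ k) :
    S2 ![0, ((k : ℝ) * s) • siteVec x] = (k : ℝ) ^ (-a) * S2 ![0, s • siteVec x] := by
  set m : ℕ → ℕ := fun j => ⌊s / u j⌋₊ with hm
  have hk0 : (0 : ℝ) < k := by exact_mod_cast hk
  have hxv : siteVec x ≠ 0 := siteVec_ne_zero hx
  have hsx : s • siteVec x ≠ 0 := smul_ne_zero hs.ne' hxv
  have hksx : ((k : ℝ) * s) • siteVec x ≠ 0 := smul_ne_zero (mul_pos hk0 hs).ne' hxv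
  -- the two sequences of rescaled sites and their limits
  have hA : Tendsto (fun j => ρ (u j) ^ 2 * criticalTwoPoint 3 (fun i => ((m j : ℕ) : ℤ) * x i))
      atTop (𝓝 (S2 ![0, s • siteVec x])) := by
    refine tendsto_rescaled_movingSite hu hconv2 hsx ?_
    have h := (tendsto_mul_natFloor_div hu hs).smul_const (siteVec x)
    refine h.congr fun j => ?_
    simp only [hm, siteVec_intMul, smul_smul]
    push_cast
    ring_nf
  have hB : Tendsto (fun j => ρ (u j) ^ 2 * criticalTwoPoint 3 (fun i => ((k * m j : ℕ) : ℤ) * x i))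
      atTop (𝓝 (S2 ![0, ((k : ℝ) * s) • siteVec x])) := by
    refine tendsto_rescaled_movingSite hu hconv2 hksx ?_
    have h := ((tendsto_mul_natFloor_div hu hs).const_mul (k : ℝ)).smul_const (siteVec x)
    refine h.congr fun j => ?_
    simp only [hm, siteVec_intMul, smul_smul]
    push_cast
    ring_nf
  -- the ratio tends to `k^{-a}` by ray regular variation along `m_j → ∞`
  have hmtop : Tendsto m atTop atTop := by
    have h1 : Tendsto (fun j => s / u j) atTop atTop := by
      have h := (tendsto_inv_nhdsGT_zero.comp hu).const_mul_atTop hs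
      refine h.congr fun j => ?_
      simp [div_eq_mul_inv]
    exact tendsto_nat_floor_atTop.comp h1
  have hR := (hRV x hx k hk).comp hmtop
  -- the ratio of the two sequences
  have hApos : 0 < S2 ![0, s • siteVec x] := hpos _ (zero_pair_mem_nonCoincident hsx)
  have hQ := hB.div hA hApos.ne'
  have hev : ∀ᶠ j in atTop, ρ (u j) ^ 2 * criticalTwoPoint 3 (fun i => ((k * m j : ℕ) : ℤ) * x i) /
      (ρ (u j) ^ 2 * criticalTwoPoint 3 (fun i => ((m j : ℕ) : ℤ) * x i)) =
      criticalTwoPoint 3 (fun i => ((k * m j : ℕ) : ℤ) * x i) /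
        criticalTwoPoint 3 (fun i => ((m j : ℕ) : ℤ) * x i) := by
    filter_upwards [eventually_mem_Ioo_of_tendsto_nhdsGT' hu one_pos] with j hj
    have hρj : 0 < ρ (u j) := hρ _ ⟨hj.1, hj.2.le⟩
    rw [mul_div_mul_left _ _ (pow_pos hρj 2).ne']
  have hlim := tendsto_nhds_unique (hQ.congr' hev) hR
  rw [div_eq_iff hApos.ne'] at hlim
  exact hlim

/-- **Homogeneity of the kernel of a sequential pair limit under ray regular variation**:
`S₂(0, c y) = c^{-a} S₂(0, y)` for all `c > 0` and `y ≠ 0` — from `kernel_ray_scaling_of_rayRV` at the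
rational dilations `⌊Nc⌋/N` of the rational points `N⁻¹ ⌊N y⌋`, and the continuity of the kernel off
the origin. [cite: DuminilCopinICM2022, §8.4] -/
theorem kernel_homogeneous_of_rayRV {a : ℝ} (hRV : RayRV[a]) {ρ : ℝ → ℝ}
    (hρ : ∀ δ ∈ Set.Ioc (0:ℝ) 1, 0 < ρ δ) {u : ℕ → ℝ} (hu : Tendsto u atTop (𝓝[>] (0 : ℝ)))
    {S2 : (Fin 2 → EuclideanSpace ℝ (Fin 3)) → ℝ}
    (hconv2 : TendstoLocallyUniformlyOn (fun k => rescaledCorrelator (criticalCorr 3) ρ 2 (u k)) S2 atTop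
      (NonCoincident 3 2))
    (hpos : ∀ z ∈ NonCoincident 3 2, 0 < S2 z)
    {c : ℝ} (hc : 0 < c) {y : EuclideanSpace ℝ (Fin 3)} (hy : y ≠ 0) :
    S2 ![0, c • y] = c ^ (-a) * S2 ![0, y] := by
  -- the kernel and its continuity off `0`
  set K : EuclideanSpace ℝ (Fin 3) → ℝ := fun w => S2 ![0, w] with hK
  have hKcont : ContinuousOn K {0}ᶜ :=
    (continuousOn_seqLimit hu hconv2).comp continuous_zeroPair.continuousOn
      fun _ hw => zero_pair_mem_nonCoincident hw
  -- meshes `1/(N+1)`, rational points `P_N = (N+1)⁻¹ ⌊(N+1) y⌋ → y`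
  set δ : ℕ → ℝ := fun N => 1 / ((N:ℝ) + 1) with hδ
  have hδpos : ∀ N, 0 < δ N := fun N => by rw [hδ]; positivity
  have hδlim : Tendsto δ atTop (𝓝[>] (0:ℝ)) := MoebiusLimitExistsNegative.tendsto_div_succ_nhdsGT one_pos
  set xN : ℕ → Site 3 := fun N => latticeApprox (δ N) y with hxN
  set P : ℕ → EuclideanSpace ℝ (Fin 3) := fun N => δ N • siteVec (xN N) with hP
  have hPlim : Tendsto P atTop (𝓝 y) := (tendsto_smul_siteVec_latticeApprox y).comp hδlim
  -- rational dilation factors `q_N = ⌊(N+1) c⌋ / (N+1) → c`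
  set kN : ℕ → ℕ := fun N => ⌊c / δ N⌋₊ with hkN
  set q : ℕ → ℝ := fun N => δ N * (kN N : ℝ) with hq
  have hqlim : Tendsto q atTop (𝓝 c) := tendsto_mul_natFloor_div hδlim hc
  -- eventually `x_N ≠ 0` and `k_N ≥ 1`
  have hxev : ∀ᶠ N in atTop, xN N ≠ 0 := by
    have h : ∀ᶠ N in atTop, P N ≠ 0 := hPlim.eventually (isOpen_compl_singleton.mem_nhds hy)
    filter_upwards [h] with N hN h0
    exact hN (by rw [hP]; simp only [h0, siteVec_zero, smul_zero])
  have hkev : ∀ᶠ N in atTop, 1 ≤ kN N := by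
    have h1 : Tendsto (fun N => c / δ N) atTop atTop := by
      have h := (tendsto_inv_nhdsGT_zero.comp hδlim).const_mul_atTop hc
      refine h.congr fun N => ?_
      simp [div_eq_mul_inv]
    exact (tendsto_nat_floor_atTop.comp h1).eventually_ge_atTop 1
  -- the scaling identity at the rational points
  have hid : ∀ᶠ N in atTop, K (q N • P N) = q N ^ (-a) * K (P N) := by
    filter_upwards [hxev, hkev] with N hxN0 hk1
    have hk0 : (0:ℝ) < kN N := by exact_mod_cast hk1
    have hN0 : (0:ℝ) < (N:ℝ) + 1 := by positivity
    -- `s' = δ_N / (N+1)`, so that `P_N = ((N+1) s') x̂_N` and `q_N P_N = (k_N s') x̂_N`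
    set s' : ℝ := δ N / ((N:ℝ) + 1) with hs'
    have hs'pos : 0 < s' := div_pos (hδpos N) hN0
    have h1 := kernel_ray_scaling_of_rayRV hRV hρ hu hconv2 hpos hxN0 hs'pos hk1
    have h2 := kernel_ray_scaling_of_rayRV hRV hρ hu hconv2 hpos hxN0 hs'pos
      (k := N + 1) (Nat.succ_le_succ (Nat.zero_le N))
    have hP' : P N = (((N + 1 : ℕ) : ℝ) * s') • siteVec (xN N) := by
      rw [hP, hs']
      push_cast
      field_simp
    have hQ' : q N • P N = (((kN N : ℕ) : ℝ) * s') • siteVec (xN N) := by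
      rw [hP, smul_smul, hq, hs']
      congr 1
      rw [hδ]
      field_simp
    have hKP : K (P N) = (((N + 1 : ℕ) : ℝ)) ^ (-a) * K (s' • siteVec (xN N)) := by
      rw [hP']; exact h2
    have hKQ : K (q N • P N) = ((kN N : ℕ) : ℝ) ^ (-a) * K (s' • siteVec (xN N)) := by
      rw [hQ']; exact h1
    have hNa : (0:ℝ) < (((N + 1 : ℕ) : ℝ)) ^ (-a) := Real.rpow_pos_of_pos (by positivity) _
    have hKs : K (s' • siteVec (xN N)) = K (P N) / (((N + 1 : ℕ) : ℝ)) ^ (-a) := by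
      rw [hKP, mul_div_cancel_left₀ _ hNa.ne']
    rw [hKQ, hKs]
    have hqa : q N ^ (-a) = ((kN N : ℕ) : ℝ) ^ (-a) / (((N + 1 : ℕ) : ℝ)) ^ (-a) := by
      rw [← Real.div_rpow hk0.le (by positivity), hq, hδ]
      congr 1
      push_cast
      field_simp
    rw [hqa]
    ring
  -- pass to the limit `N → ∞` on both sides
  have hcy : c • y ≠ 0 := smul_ne_zero hc.ne' hy
  have hL : Tendsto (fun N => K (q N • P N)) atTop (𝓝 (K (c • y))) := by
    have hcont : ContinuousAt K (c • y) :=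
      hKcont.continuousAt (isOpen_compl_singleton.mem_nhds hcy)
    exact hcont.tendsto.comp (hqlim.smul hPlim)
  have hRlim : Tendsto (fun N => q N ^ (-a) * K (P N)) atTop (𝓝 (c ^ (-a) * K y)) := by
    have hcont : ContinuousAt K y := hKcont.continuousAt (isOpen_compl_singleton.mem_nhds hy)
    exact (hqlim.rpow_const (Or.inl hc.ne')).mul (hcont.tendsto.comp hPlim)
  exact tendsto_nhds_unique (hL.congr' hid) hRlim

end Summit.CriticalPhenomena.Ising3DConformalLimit.HarmonicMomentsIsotropyTwoPoint.RayRV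

end
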